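import Mathlib
import Summits.Ventures.DiscreteObjects.Mahler.FourTermAbsTwo
import Summits.Ventures.DiscreteObjects.Mahler.FourTermSpecialFamily
import Summits.Ventures.DiscreteObjects.Mahler.TrinomialSmythBound
import Summits.Ventures.DiscreteObjects.Mahler.SmythTheorem
import Summits.Ventures.DiscreteObjects.Mahler.UnitMeasureFactors
import Summits.Ventures.DiscreteObjects.Mahler.MahlerMeasureCompXPow
import Summits.Ventures.DiscreteObjects.Mahler.SubLehmerDegreeTwentyFour

/-!
# No integer polynomial with at most four monomials is sub-Lehmer (venture `DiscreteObjects`, target L)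

Cell `pub-namedobj`, seat `pub-namedobj-mahler-g24`. Framing: lottery ticket; floor = certified
bounds/negative ranges.

**Theorem** (`not_subLehmer_of_card_support_le_four`; a kernel formalisation of a weak form of
[Dobrowolski2006, Prop. 2]).  If `P ∈ ℤ[X]` has at most four nonzero coefficients then it is not sub-Lehmer:
`M(P) ∉ (1, M(ℓ))`, `M(ℓ) = 1.17628…`, with NO hypothesis on `P` (reducible, cyclotomic factors, any height).  Assembly of the case analysis:
`P = x^j P₀`, `P₀(0) ≠ 0`; `P₀` constant (integer measure); `P₀` nonreciprocal (Smyth's theorem, `M ≥ θ₀`);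
leading coefficient `≥ 2` (`M ≥ 2`); `±P₀` monic (anti)reciprocal with support `{0,n}` (`M = 1`),
`{0, m, 2m}` (`P₀ = R(x^m)`, `deg R = 2`, kernel ladder), or `{0, p, q, p+q}`:
`P₀ = x^{p+q} + b x^p + εb x^q + ε` with `|b| = 1` (`(x^p + εb)(x^q + b)`, `M = 1`), `|b| = 2`
(`FourTermAbsTwo`), `|b| ≥ 3` (`FourTermSpecialFamily` + `FourTermCyclotomicFactors`).

Census reading (cell `pub-namedobj`, target L): a polynomial of measure in `(1, M(ℓ))` — the ticket — has
at least five monomials; five monomials do occur AT `M(ℓ)`: `x¹² - x⁷ - x⁶ - x⁵ + 1 = ℓ(x) Φ₆(x)`.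
IN PRINT (this is a REPLICATION / kernel formalisation): [Dobrowolski2006] E. Dobrowolski, "Mahler's measure of a
polynomial in terms of the number of its monomials", Acta Arith. 123 (2006) 201–231, Proposition 2: every monic
quadrinomial `f ∈ ℤ[x]` with `f(0) ≠ 0` that is not a product of cyclotomic polynomials has `M(f) ≥ θ₀ = 1.3247…`
(sharp: `x⁴ - x³ - x² + 1 = (x - 1)(x³ - x - 1)`; quoted in Smyth, Proc. AMS 146 (2018) §8 as "the minimal Mahler
measure of all integer noncyclotomic quadrinomials").  The kernel proof follows the same route (congruences
`a ∣ αⁿ + η`, roots of unity among the zeros, multiplicity `≤ 3`, the doubling for `a = 2`); Dobrowolski settles a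
residual finite set "by direct computation of `M(f)`", which the kernel version replaces by the cell's degree-`≤ 23`
census — hence the weaker constant `M(ℓ)` in Theorem S.  See also Dobrowolski–Smyth, IJNT 13 (2017), Thm 1
(`M ≥ h/2^{k-2}` for `k`-nomials).
-/

namespace Summit.Ventures.DiscreteObjects.Mahler

open Polynomial

/-- A sub-Lehmer measure is not an integer `≥ 2` and exceeds `1`: `M(C c) = |c|` is never sub-Lehmer. -/
theorem not_subLehmer_C (c : ℤ) : ¬ SubLehmer (C c) := by
  intro h
  obtain ⟨h1, h2⟩ := h
  have hL := lehmer_measure_upper_bound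
  rw [intMahlerMeasure_C] at h1 h2
  have h3 : (2 : ℝ) ≤ |(c : ℝ)| := by
    have h1' : (1 : ℤ) < |c| := by exact_mod_cast h1
    have : (2 : ℤ) ≤ |c| := h1'
    exact_mod_cast this
  linarith

/-- **Monic (anti)reciprocal polynomials with at most four monomials are not sub-Lehmer.**  `P` monic
of degree `n ≥ 1` with `P_{n-i} = ε P_i` (`ε = ±1`) and at most four nonzero coefficients: support
`{0,n}`, `{0,m,2m}` or `{0,p,q,p+q}`, treated by `M(xⁿ + ε) = 1`, the kernel ladder for the quadratic
`R` with `P = R(x^m)`, and the quadrinomial theorems (`|b| = 1`: cyclotomic; `|b| = 2`; `|b| ≥ 3`). -/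
theorem not_subLehmer_of_monic_reciprocal_sparse {P : ℤ[X]} {ε : ℤ} (hε : ε = 1 ∨ ε = -1)
    (hmon : P.Monic) (hdeg : 0 < P.natDegree)
    (hrel : ∀ i ≤ P.natDegree, P.coeff (P.natDegree - i) = ε * P.coeff i)
    (hcard : P.support.card ≤ 4) : ¬ SubLehmer P := by
  set n := P.natDegree with hn
  have hεε : ε * ε = 1 := by rcases hε with h | h <;> simp [h]
  have hε0 : ε ≠ 0 := by rcases hε with h | h <;> simp [h]
  have hcn : P.coeff n = 1 := hmon.coeff_natDegree
  have hc0 : P.coeff 0 = ε := by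
    have h := hrel 0 (Nat.zero_le _)
    rw [Nat.sub_zero, hcn] at h
    linear_combination (-ε) * h + (-(P.coeff 0)) * hεε
  set S := (P.support.erase n).erase 0 with hS
  have hmemS : ∀ k, k ∈ S ↔ k ≠ 0 ∧ k ≠ n ∧ P.coeff k ≠ 0 := by
    intro k; simp only [hS, Finset.mem_erase, mem_support_iff]
  have hScard : S.card ≤ 2 := by
    have h1 : n ∈ P.support := mem_support_iff.mpr (by rw [hcn]; exact one_ne_zero)
    have h2 : 0 ∈ P.support.erase n := Finset.mem_erase.mpr ⟨by omega, mem_support_iff.mpr (by rw [hc0]; exact hε0)⟩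
    have e1 : S.card = (P.support.erase n).card - 1 := Finset.card_erase_of_mem h2
    have e2 : (P.support.erase n).card = P.support.card - 1 := Finset.card_erase_of_mem h1
    omega
  have hzero : ∀ k, k ∉ S → k ≠ 0 → k ≠ n → P.coeff k = 0 := by
    intro k hk hk0 hkn
    by_contra h
    exact hk ((hmemS k).mpr ⟨hk0, hkn, h⟩)
  have hsymm : ∀ k ∈ S, n - k ∈ S := by
    intro k hk
    obtain ⟨hk0, hkn, hkc⟩ := (hmemS k).mp hk
    have hkle : k ≤ n := le_natDegree_of_ne_zero hkc
    refine (hmemS _).mpr ⟨by omega, by omega, ?_⟩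
    rw [hrel k hkle]
    exact mul_ne_zero hε0 hkc
  have hS3 : S.card = 0 ∨ S.card = 1 ∨ S.card = 2 := by omega
  rcases hS3 with h0 | h1 | h2
  · -- `P = xⁿ + ε`, `M = 1`
    have hSe : S = ∅ := Finset.card_eq_zero.mp h0
    have hP : P = X ^ n + C ε := by
      ext k
      simp only [coeff_add, coeff_X_pow, coeff_C]
      by_cases hk0 : k = 0
      · subst hk0; rw [if_neg (by omega), if_pos rfl, hc0, zero_add]
      by_cases hkn : k = n
      · subst hkn; rw [if_pos rfl, if_neg hk0, hcn, add_zero]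
      rw [if_neg hkn, if_neg hk0, add_zero]
      exact hzero k (by rw [hSe]; exact Finset.notMem_empty k) hk0 hkn
    intro hsub
    have h1 := hsub.1
    rw [hP, intMahlerMeasure_X_pow_add_sign hε hdeg] at h1
    exact lt_irrefl _ h1
  · -- `P = R(x^m)` with `R = x² + c x + 1`
    obtain ⟨m, hSm⟩ := Finset.card_eq_one.mp h1
    have hmS : m ∈ S := by rw [hSm]; exact Finset.mem_singleton_self m
    obtain ⟨hm0, hmn, hmc⟩ := (hmemS m).mp hmS
    have hmle : m ≤ n := le_natDegree_of_ne_zero hmc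
    have hnm : n - m = m := by
      have h := hsymm m hmS
      rw [hSm, Finset.mem_singleton] at h
      exact h
    have hn2 : n = 2 * m := by omega
    have hmpos : 0 < m := Nat.pos_of_ne_zero hm0
    have hε1 : ε = 1 := by
      rcases hε with h | h
      · exact h
      · exfalso
        have h2 := hrel m hmle
        rw [hnm, h] at h2
        have : P.coeff m = 0 := by linarith
        exact hmc this
    set c := P.coeff m with hc
    have hP : P = (X ^ 2 + C c * X + C 1 : ℤ[X]).comp (X ^ m) := by
      have e : (X ^ 2 + C c * X + C 1 : ℤ[X]).comp (X ^ m) = X ^ (2 * m) + C c * X ^ m + C 1 := by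
        simp only [add_comp, mul_comp, pow_comp, X_comp, C_comp]
        rw [← pow_mul, mul_comm]
      rw [e]
      ext k
      simp only [coeff_add, coeff_X_pow, coeff_C_mul, coeff_C]
      by_cases hk0 : k = 0
      · subst hk0
        rw [if_neg (by omega), if_neg (by omega), if_pos rfl, hc0, hε1]; ring
      by_cases hkn : k = 2 * m
      · subst hkn
        rw [if_pos rfl, if_neg (by omega), if_neg (by omega), ← hn2, hcn]; ring
      by_cases hkm : k = m
      · subst hkm
        rw [if_neg hkn, if_pos rfl, if_neg hk0]; ring
      rw [if_neg hkn, if_neg hkm, if_neg hk0]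
      have : k ∉ S := by rw [hSm, Finset.mem_singleton]; exact hkm
      rw [hzero k this hk0 (by omega)]; ring
    intro hsub
    have hsubR : SubLehmer (X ^ 2 + C c * X + C 1 : ℤ[X]) := by
      unfold SubLehmer at hsub ⊢
      rwa [hP, intMahlerMeasure_comp_X_pow _ hmpos] at hsub
    have h24 := twentyfour_le_natDegree_of_subLehmer hsubR
    have hR : (X ^ 2 + C c * X + C 1 : ℤ[X]).natDegree ≤ 2 := by
      refine (natDegree_add_le _ _).trans (max_le ((natDegree_add_le _ _).trans (max_le ?_ ?_)) ?_)
      · rw [natDegree_X_pow]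
      · exact (natDegree_C_mul_le _ _).trans (by rw [natDegree_X]; omega)
      · rw [natDegree_C]; omega
    omega
  · -- the quadrinomial `x^{i+j} + b x^i + ε b x^j + ε`
    obtain ⟨i, j, hij, hSij⟩ := Finset.card_eq_two.mp h2
    wlog hlt : i < j generalizing i j
    · exact this j i hij.symm (by rw [hSij, Finset.pair_comm]) (by omega)
    have hiS : i ∈ S := by rw [hSij]; simp
    have hjS : j ∈ S := by rw [hSij]; simp
    obtain ⟨hi0, hin, hic⟩ := (hmemS i).mp hiS
    obtain ⟨hj0, hjn, hjc⟩ := (hmemS j).mp hjS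
    have hile : i ≤ n := le_natDegree_of_ne_zero hic
    have hjle : j ≤ n := le_natDegree_of_ne_zero hjc
    have h1 := hsymm i hiS
    have h2' := hsymm j hjS
    rw [hSij, Finset.mem_insert, Finset.mem_singleton] at h1 h2'
    have hnij : n = i + j := by omega
    have hipos : 0 < i := Nat.pos_of_ne_zero hi0
    set b := P.coeff i with hb
    have hcj : P.coeff j = ε * b := by
      have h := hrel i hile
      rwa [show n - i = j by omega] at h
    have hP : P = X ^ (i + j) + C b * X ^ i + C (ε * b) * X ^ j + C ε := by
      ext k
      simp only [coeff_add, coeff_X_pow, coeff_C_mul, coeff_C]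
      by_cases hk0 : k = 0
      · subst hk0
        rw [if_neg (by omega), if_neg (by omega), if_neg (by omega), if_pos rfl, hc0]; ring
      by_cases hkn : k = i + j
      · subst hkn
        rw [if_pos rfl, if_neg (by omega), if_neg (by omega), if_neg (by omega), ← hnij, hcn]; ring
      by_cases hki : k = i
      · subst hki
        rw [if_neg hkn, if_pos rfl, if_neg (by omega), if_neg hk0]; ring
      by_cases hkj : k = j
      · subst hkj
        rw [if_neg hkn, if_neg (by omega), if_pos rfl, if_neg hk0, hcj]; ring
      rw [if_neg hkn, if_neg hki, if_neg hkj, if_neg hk0]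
      have : k ∉ S := by rw [hSij, Finset.mem_insert, Finset.mem_singleton]; exact not_or.mpr ⟨hki, hkj⟩
      rw [hzero k this hk0 (by omega)]; ring
    rw [hP]
    have hb0 : b ≠ 0 := hic
    by_cases hb1 : |b| = 1
    · -- `(x^i + εb)(x^j + b)`, measure `1`
      have hbs : b = 1 ∨ b = -1 := by
        rcases abs_choice b with h | h <;> rw [h] at hb1 <;> omega
      have hbb : b * b = 1 := by rcases hbs with h | h <;> simp [h]
      have hfac : (X ^ (i + j) + C b * X ^ i + C (ε * b) * X ^ j + C ε : ℤ[X]) =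
          (X ^ i + C (ε * b)) * (X ^ j + C b) := by
        have hCb : (C b : ℤ[X]) * C b = 1 := by rw [← map_mul, hbb, map_one]
        rw [map_mul, pow_add]
        linear_combination (-(C ε : ℤ[X])) * hCb
      intro hsub
      have h1 := hsub.1
      have hεb : ε * b = 1 ∨ ε * b = -1 := by
        rcases hε with h | h <;> rcases hbs with h' | h' <;> simp [h, h']
      rw [hfac, intMahlerMeasure_mul, intMahlerMeasure_X_pow_add_sign hεb hipos,
        intMahlerMeasure_X_pow_add_sign hbs (by omega), mul_one] at h1
      exact lt_irrefl _ h1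
    by_cases hb2 : |b| = 2
    · have hb2' : b = 2 ∨ b = -2 := by
        rcases abs_choice b with h | h <;> rw [h] at hb2 <;> omega
      exact not_subLehmer_quadrinomial_two hipos hlt hε hb2'
    · have hb3 : 3 ≤ |b| := by
        have := abs_pos.mpr hb0
        omega
      exact not_subLehmer_quadrinomial_of_three_le_abs' hipos hlt hε hb3

/-- **No integer polynomial with at most four monomials is sub-Lehmer**: if `P ∈ ℤ[X]` has at most four
nonzero coefficients then `¬ (1 < M(P) < M(ℓ))` (in print with the sharp constant `θ₀`: [Dobrowolski2006,
Prop. 2]); five monomials occur at `M(ℓ)` itself (`x¹² - x⁷ - x⁶ - x⁵ + 1 = ℓ · Φ₆`). -/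
theorem not_subLehmer_of_card_support_le_four (P : ℤ[X]) (hcard : P.support.card ≤ 4) : ¬ SubLehmer P := by
  intro hsub
  have hL := lehmer_measure_upper_bound
  have hP0 : P ≠ 0 := by
    intro h; have h1 := hsub.1; rw [h] at h1
    unfold intMahlerMeasure at h1; simp at h1; linarith
  -- strip the power of `x`
  obtain ⟨P₀, hP₀, hndvd⟩ := exists_eq_pow_rootMultiplicity_mul_and_not_dvd P hP0 0
  rw [map_zero, sub_zero] at hP₀ hndvd
  set j := P.rootMultiplicity 0 with hj
  have hc0 : P₀.coeff 0 ≠ 0 := fun h => hndvd (X_dvd_iff.mpr h)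
  have hM : intMahlerMeasure P = intMahlerMeasure P₀ := by
    rw [hP₀, intMahlerMeasure_mul, intMahlerMeasure_X_pow, one_mul]
  have hcard₀ : P₀.support.card ≤ 4 := by rw [← card_support_X_pow_mul P₀ j, ← hP₀]; exact hcard
  have hsub₀ : SubLehmer P₀ := by unfold SubLehmer at hsub ⊢; rwa [hM] at hsub
  have hP₀0 : P₀ ≠ 0 := fun h => hc0 (by rw [h, coeff_zero])
  -- constant?
  rcases Nat.eq_zero_or_pos P₀.natDegree with hd0 | hdpos
  · rw [eq_C_of_natDegree_eq_zero hd0] at hsub₀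
    exact not_subLehmer_C _ hsub₀
  -- nonreciprocal: Smyth
  by_cases hrev : P₀.reverse = P₀ ∨ P₀.reverse = -P₀
  swap
  · obtain ⟨h1, h2⟩ := not_or.mp hrev
    have h := intMahlerMeasure_ge_smythTheta_of_nonreciprocal hc0 h1 h2
    linarith [smythTheta_gt, hsub₀.2]
  -- (anti)reciprocal: coefficient form
  obtain ⟨ε, hε, hrel⟩ : ∃ ε : ℤ, (ε = 1 ∨ ε = -1) ∧
      ∀ i ≤ P₀.natDegree, P₀.coeff (P₀.natDegree - i) = ε * P₀.coeff i := by
    rcases hrev with h | h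
    · refine ⟨1, Or.inl rfl, fun i hi => ?_⟩
      have hc := congrArg (fun Q : ℤ[X] => Q.coeff i) h
      simp only [coeff_reverse, revAt_le hi] at hc
      rw [hc, one_mul]
    · refine ⟨-1, Or.inr rfl, fun i hi => ?_⟩
      have hc := congrArg (fun Q : ℤ[X] => Q.coeff i) h
      simp only [coeff_reverse, revAt_le hi, coeff_neg] at hc
      rw [hc]; ring
  -- leading coefficient `± 1`, else `M ≥ 2`
  by_cases hlc : 2 ≤ |P₀.leadingCoeff|
  · have h := abs_leadingCoeff_le_intMahlerMeasure P₀
    have : (2 : ℝ) ≤ |(P₀.leadingCoeff : ℝ)| := by exact_mod_cast hlc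
    linarith [hsub₀.2]
  have hlc1 : P₀.leadingCoeff = 1 ∨ P₀.leadingCoeff = -1 := by
    have hne : P₀.leadingCoeff ≠ 0 := leadingCoeff_ne_zero.mpr hP₀0
    have hnn := abs_nonneg P₀.leadingCoeff
    rcases abs_choice P₀.leadingCoeff with h | h <;> rw [h] at hlc hnn <;> omega
  rcases hlc1 with h1 | h1
  · exact not_subLehmer_of_monic_reciprocal_sparse hε h1 hdpos hrel hcard₀ hsub₀
  · have hmon : (-P₀).Monic := by rw [Monic, leadingCoeff_neg, h1, neg_neg]
    refine not_subLehmer_of_monic_reciprocal_sparse (ε := ε) hε hmon (by rwa [natDegree_neg]) ?_ ?_ ?_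
    · intro i hi
      rw [natDegree_neg] at hi ⊢
      rw [coeff_neg, coeff_neg, hrel i hi]; ring
    · rwa [support_neg]
    · unfold SubLehmer at hsub₀ ⊢; rwa [intMahlerMeasure_neg]

/-- **A sub-Lehmer integer polynomial has at least five monomials** (no hypothesis). -/
theorem five_le_card_support_of_subLehmer' {P : ℤ[X]} (hP : SubLehmer P) : 5 ≤ P.support.card := by
  by_contra h
  exact not_subLehmer_of_card_support_le_four P (by omega) hP

end Summit.Ventures.DiscreteObjects.Mahler
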